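import Literature.Probability.Percolation.TripodExchange
import Literature.Probability.Percolation.PercolationProofs
import Literature.Probability.Percolation.KozmaNitzanPreFKG
import HarnessLib

/-!
# `NoHeavyLowerTail` (stmt-CriticalPhenomena-4575) — the one-cut bound for at most three relays, UNCONDITIONALLY

Support file for the crux `Summit.CriticalPhenomena.PercolationContinuityZ3.Theses.PercNearOneGluing.NoHeavyLowerTail`
(stmt-CriticalPhenomena-4575), line `one-cut` (strategist r2): the ONE-CUT BOUND

  `P(1 ≤ N ∧ N < E N / 2) ≤ t` whenever every pairwise disconnection among distinct relays is `≤ t`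
  (`N = |{a ∈ A : o ↔ a}|`, `E N = Σ_{a ∈ A} P(o ↔ a)`)

is the typed open kernel of `Theorems.noHeavyLowerTail_of_oneCut`.  This file PROVES it for `A.card ≤ 3`
(`oneCut_card_le_three`), with no hypothesis, from the tripod exchange inequality (C⁺)
`Literature.Probability.Percolation.tripodExchange` (van den Berg–Häggström–Kahn 2006, Thm. 1.5, four times).

Derivation.  For `|A| ≤ 3` one has `E N ≤ 3`, so `{1 ≤ N < E N/2} ⊆ {N = 1}` (and the event is empty when
`E N ≤ 2`, in particular when `|A| ≤ 2`).  For three relays `a, b, c` write `E_a = {o ↔ a, o ↮ b, o ↮ c}` etc.,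
`S_a = P(oa|bc)`, `S_b = P(ob|ac)` (2+2 splits) and `T_a = P(obc|a)`, `T_b = P(oac|b)` (one relay isolated).
ONE instance of (C⁺), with `(x, y, z) = (a, b, c)`, reads `S_a · S_b ≤ T_b · T_a`, hence `S_a ≤ T_b` or
`S_b ≤ T_a` (`lonelyRelay_three`).  If `S_a ≤ T_b` then `P(N = 1) ≤ P(b ↮ c)`: the events `E_b`, `E_c`,
`E_a ∩ {b ↮ c}` and `{oac|b}` are pairwise disjoint subsets of `{b ↮ c}`, and `P(E_a ∩ {b ↔ c}) = S_a ≤ T_b =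
P(oac|b)` (`lonelyRelay_three_of_le`); symmetrically `S_b ≤ T_a` gives `P(N = 1) ≤ P(a ↮ c)`.  So
`P(N = 1) ≤ max_{a ≠ a'} P(a ↮ a')` for three relays — the `|A| = 3` rung ("R1′ / LonelyRelay3") of the
line card, now a theorem.
-/

noncomputable section

namespace Summit.CriticalPhenomena.PercolationContinuityZ3.Theorems

open MeasureTheory Set Literature.Probability.LatticeModels Literature.Probability.Percolation
open scoped Classical BigOperators

variable {V : Type*} [Fintype V]

/-- **Lonely relay, one-sided form.**  If `P(oa|bc) ≤ P(oac|b)` then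
`P(E_a) + P(E_b) + P(E_c) ≤ P(b ↮ c)`, where `E_a = {o ↔ a} ∩ {o ↮ b} ∩ {o ↮ c}` etc. are the
"exactly the relay `a` is joined to `o`" events: `E_b`, `E_c`, `E_a ∩ {b ↮ c}`, `{oac|b}` are pairwise
disjoint subsets of `{b ↮ c}` and `P(E_a ∩ {b ↔ c}) = P(oa|bc) ≤ P(oac|b)`. [this file] -/
theorem lonelyRelay_three_of_le (w : Sym2 V → unitInterval) (o a b c : V)
    (h : (prodBernoulli w).real (openConn o a ∩ openConn b c ∩ (openConn a b)ᶜ) ≤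
      (prodBernoulli w).real (openConn o a ∩ openConn a c ∩ (openConn a b)ᶜ)) :
    (prodBernoulli w).real (openConn o a ∩ (openConn o b)ᶜ ∩ (openConn o c)ᶜ) +
        (prodBernoulli w).real (openConn o b ∩ (openConn o a)ᶜ ∩ (openConn o c)ᶜ) +
        (prodBernoulli w).real (openConn o c ∩ (openConn o a)ᶜ ∩ (openConn o b)ᶜ) ≤
      (prodBernoulli w).real (openConn b c)ᶜ := by
  set μ := prodBernoulli w with hμ
  have mem : ∀ (ω : BondConfig V) (u v : V),
      ω ∈ (openConn u v : Set (BondConfig V)) ↔ (openGraph ω).Reachable u v := fun _ _ _ => Iff.rfl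
  set Ea := (openConn o a ∩ (openConn o b)ᶜ ∩ (openConn o c)ᶜ : Set (BondConfig V)) with hEa
  set Eb := (openConn o b ∩ (openConn o a)ᶜ ∩ (openConn o c)ᶜ : Set (BondConfig V)) with hEb
  set Ec := (openConn o c ∩ (openConn o a)ᶜ ∩ (openConn o b)ᶜ : Set (BondConfig V)) with hEc
  set Tb := (openConn o a ∩ openConn a c ∩ (openConn a b)ᶜ : Set (BondConfig V)) with hTb
  set D := ((openConn b c)ᶜ : Set (BondConfig V)) with hD
  -- split `E_a` along `{b ↔ c}`
  have hsplit : μ.real (Ea ∩ openConn b c) + μ.real (Ea \ openConn b c) = μ.real Ea :=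
    measureReal_inter_add_sdiff MeasurableSet.of_discrete
  -- `E_a ∩ {b ↔ c} ⊆ {oa|bc}`
  have h1 : μ.real (Ea ∩ openConn b c) ≤
      μ.real (openConn o a ∩ openConn b c ∩ (openConn a b)ᶜ) := by
    refine measureReal_mono (fun ω hω => ?_)
    simp only [hEa, mem_inter_iff, mem_compl_iff, mem] at hω ⊢
    obtain ⟨⟨⟨hoa, hob⟩, -⟩, hbc⟩ := hω
    exact ⟨⟨hoa, hbc⟩, fun hab => hob (hoa.trans hab)⟩
  -- the four disjoint pieces of `{b ↮ c}`
  have dTE : Disjoint Tb (Ea \ openConn b c) := by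
    refine Set.disjoint_left.2 fun ω h1 h2 => ?_
    simp only [hTb, hEa, mem_inter_iff, mem_compl_iff, mem_sdiff, mem] at h1 h2
    exact h2.1.2 (h1.1.1.trans h1.1.2)
  have dTEb : Disjoint (Tb ∪ (Ea \ openConn b c)) Eb := by
    refine Set.disjoint_left.2 fun ω h1 h2 => ?_
    simp only [hTb, hEa, hEb, mem_union, mem_inter_iff, mem_compl_iff, mem_sdiff, mem] at h1 h2
    rcases h1 with h1 | h1
    · exact h2.1.2 h1.1.1
    · exact h1.1.1.2 h2.1.1
  have dTEbc : Disjoint (Tb ∪ (Ea \ openConn b c) ∪ Eb) Ec := by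
    refine Set.disjoint_left.2 fun ω h1 h2 => ?_
    simp only [hTb, hEa, hEb, hEc, mem_union, mem_inter_iff, mem_compl_iff, mem_sdiff, mem] at h1 h2
    rcases h1 with (h1 | h1) | h1
    · exact h2.1.2 h1.1.1
    · exact h1.1.2 h2.1.1
    · exact h1.2 h2.1.1
  have hU : μ.real (Tb ∪ (Ea \ openConn b c) ∪ Eb ∪ Ec) =
      μ.real Tb + μ.real (Ea \ openConn b c) + μ.real Eb + μ.real Ec := by
    rw [measureReal_union dTEbc MeasurableSet.of_discrete,
      measureReal_union dTEb MeasurableSet.of_discrete,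
      measureReal_union dTE MeasurableSet.of_discrete]
  have hsub : Tb ∪ (Ea \ openConn b c) ∪ Eb ∪ Ec ⊆ D := by
    intro ω hω
    simp only [hTb, hEa, hEb, hEc, hD, mem_union, mem_inter_iff, mem_compl_iff, mem_sdiff, mem] at hω ⊢
    rcases hω with ((h1 | h1) | h1) | h1
    · exact fun hbc => h1.2 (h1.1.2.trans hbc.symm)
    · exact h1.2
    · exact fun hbc => h1.2 (h1.1.1.trans hbc)
    · exact fun hbc => h1.2 (h1.1.1.trans hbc.symm)
  have hle : μ.real (Tb ∪ (Ea \ openConn b c) ∪ Eb ∪ Ec) ≤ μ.real D := measureReal_mono hsub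
  linarith

/-- **Lonely relay lemma for three relays (R1′ of line one-cut), unconditional.**
`P(E_a) + P(E_b) + P(E_c) ≤ max (P(b ↮ c)) (P(a ↮ c))`, i.e. the probability that EXACTLY ONE of the
three relays `a, b, c` is joined to `o` is at most the largest pairwise disconnection probability.  From
one instance of the tripod exchange inequality (C⁺) `P(oa|bc) P(ob|ac) ≤ P(oac|b) P(obc|a)`
(`Literature.Probability.Percolation.tripodExchange`, BHK 2006 Thm. 1.5): either `P(oa|bc) ≤ P(oac|b)`
or `P(ob|ac) ≤ P(obc|a)`, and `lonelyRelay_three_of_le` finishes in each case.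
[cite: VandenbergHaggstromKahn2005, Thm. 1.5 — via tripodExchange] -/
theorem lonelyRelay_three (w : Sym2 V → unitInterval) (o a b c : V) :
    (prodBernoulli w).real (openConn o a ∩ (openConn o b)ᶜ ∩ (openConn o c)ᶜ) +
        (prodBernoulli w).real (openConn o b ∩ (openConn o a)ᶜ ∩ (openConn o c)ᶜ) +
        (prodBernoulli w).real (openConn o c ∩ (openConn o a)ᶜ ∩ (openConn o b)ᶜ) ≤
      max ((prodBernoulli w).real (openConn b c)ᶜ) ((prodBernoulli w).real (openConn a c)ᶜ) := by
  have cplus := Literature.Probability.Percolation.tripodExchange w o a b c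
  by_cases h1 : (prodBernoulli w).real (openConn o a ∩ openConn b c ∩ (openConn a b)ᶜ) ≤
      (prodBernoulli w).real (openConn o a ∩ openConn a c ∩ (openConn a b)ᶜ)
  · exact (lonelyRelay_three_of_le w o a b c h1).trans (le_max_left _ _)
  by_cases h2 : (prodBernoulli w).real (openConn o b ∩ openConn a c ∩ (openConn a b)ᶜ) ≤
      (prodBernoulli w).real (openConn o b ∩ openConn b c ∩ (openConn a b)ᶜ)
  · -- the symmetric case: swap the roles of `a` and `b`
    have key := lonelyRelay_three_of_le w o b a c (by rwa [KNPreFKG.openConn_symm b a])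
    have e3 : (openConn o c ∩ (openConn o b)ᶜ ∩ (openConn o a)ᶜ : Set (BondConfig V)) =
        openConn o c ∩ (openConn o a)ᶜ ∩ (openConn o b)ᶜ := by
      rw [inter_assoc, inter_comm (openConn o b)ᶜ, ← inter_assoc]
    rw [e3] at key
    calc _ = (prodBernoulli w).real (openConn o b ∩ (openConn o a)ᶜ ∩ (openConn o c)ᶜ) +
          (prodBernoulli w).real (openConn o a ∩ (openConn o b)ᶜ ∩ (openConn o c)ᶜ) +
          (prodBernoulli w).real (openConn o c ∩ (openConn o a)ᶜ ∩ (openConn o b)ᶜ) := by ring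
      _ ≤ _ := key
      _ ≤ _ := le_max_right _ _
  · exfalso
    push Not at h1 h2
    have := mul_lt_mul'' h1 h2 measureReal_nonneg measureReal_nonneg
    linarith

/-- **The one-cut bound for at most three relays (the `|A| ≤ 3` rung of the engine of
stmt-CriticalPhenomena-4575), unconditional.**  For every finite weighted graph, every relay set `A` with
`A.card ≤ 3`, every `o` and every `t ≥ 0` bounding all pairwise disconnection probabilities among distinct
relays: `P(1 ≤ N ∧ N < E N / 2) ≤ t` (`N = |{a ∈ A : o ↔ a}|`, `E N = Σ_{a∈A} P(o ↔ a)`).  Same binder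
shape as the hypothesis of `Theorems.noHeavyLowerTail_of_oneCut`, plus `A.card ≤ 3`.  Proof: `E N ≤ |A| ≤ 3`
forces `N = 1` on the event (empty if `|A| ≤ 2`), and `lonelyRelay_three` bounds `P(N = 1)`.
[cite: VandenbergHaggstromKahn2005, Thm. 1.5 — via tripodExchange] -/
theorem oneCut_card_le_three :
    ∀ (n : ℕ) (w : Sym2 (Fin n) → unitInterval) (A : Finset (Fin n)) (o : Fin n) (t : ℝ),
      A.card ≤ 3 → 0 ≤ t →
      (∀ a ∈ A, ∀ a' ∈ A, a ≠ a' →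
        (Literature.Probability.LatticeModels.prodBernoulli w).real
          (Literature.Probability.Percolation.openConn a a')ᶜ ≤ t) →
      (Literature.Probability.LatticeModels.prodBernoulli w).real
        {ω : Literature.Probability.Percolation.BondConfig (Fin n) |
          1 ≤ (A.filter fun a => ω ∈ Literature.Probability.Percolation.openConn o a).card ∧
          ((A.filter fun a => ω ∈ Literature.Probability.Percolation.openConn o a).card : ℝ) <
            (∑ a ∈ A, (Literature.Probability.LatticeModels.prodBernoulli w).real
              (Literature.Probability.Percolation.openConn o a)) / 2} ≤ t := by
  intro n w A o t hA ht hpair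
  set μ := prodBernoulli w with hμ
  have hEN : (∑ a ∈ A, μ.real (openConn o a)) ≤ (A.card : ℝ) := by
    calc (∑ a ∈ A, μ.real (openConn o a)) ≤ ∑ _a ∈ A, (1 : ℝ) :=
          Finset.sum_le_sum fun a _ => measureReal_le_one
      _ = (A.card : ℝ) := by simp
  by_cases h3 : A.card = 3
  · obtain ⟨a, b, c, hab, hac, hbc, rfl⟩ := Finset.card_eq_three.mp h3
    have hEN3 : (∑ x ∈ ({a, b, c} : Finset (Fin n)), μ.real (openConn o x)) ≤ 3 := by
      have : (({a, b, c} : Finset (Fin n)).card : ℝ) = 3 := by exact_mod_cast h3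
      linarith
    -- the event lies in `E_a ∪ E_b ∪ E_c`
    have hsub : {ω : BondConfig (Fin n) |
          1 ≤ (({a, b, c} : Finset (Fin n)).filter fun d => ω ∈ openConn o d).card ∧
          ((({a, b, c} : Finset (Fin n)).filter fun d => ω ∈ openConn o d).card : ℝ) <
            (∑ x ∈ ({a, b, c} : Finset (Fin n)), μ.real (openConn o x)) / 2} ⊆
        (openConn o a ∩ (openConn o b)ᶜ ∩ (openConn o c)ᶜ) ∪
          (openConn o b ∩ (openConn o a)ᶜ ∩ (openConn o c)ᶜ) ∪
          (openConn o c ∩ (openConn o a)ᶜ ∩ (openConn o b)ᶜ) := by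
      intro ω hω
      simp only [mem_setOf_eq] at hω
      obtain ⟨hN1, hN2⟩ := hω
      set s := ({a, b, c} : Finset (Fin n)).filter fun d => ω ∈ openConn o d with hs
      have hs2 : s.card < 2 := by
        have : (s.card : ℝ) < 2 := by linarith
        exact_mod_cast this
      have hs1 : s.card = 1 := by omega
      obtain ⟨d, hd⟩ := Finset.card_eq_one.mp hs1
      have hmem : ∀ e, e ∈ s ↔ (e = a ∨ e = b ∨ e = c) ∧ ω ∈ openConn o e := by
        intro e
        rw [hs, Finset.mem_filter, Finset.mem_insert, Finset.mem_insert, Finset.mem_singleton]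
      have hd_in : d ∈ s := by rw [hd]; exact Finset.mem_singleton_self d
      have hout : ∀ e, e ≠ d → (e = a ∨ e = b ∨ e = c) → ω ∉ openConn o e := by
        intro e hne he hoe
        have : e ∈ s := (hmem e).2 ⟨he, hoe⟩
        rw [hd, Finset.mem_singleton] at this
        exact hne this
      obtain ⟨hd_abc, hod⟩ := (hmem d).1 hd_in
      simp only [mem_union, mem_inter_iff, mem_compl_iff]
      rcases hd_abc with rfl | rfl | rfl
      · exact Or.inl (Or.inl ⟨⟨hod, hout b (Ne.symm hab) (Or.inr (Or.inl rfl))⟩,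
          hout c (Ne.symm hac) (Or.inr (Or.inr rfl))⟩)
      · exact Or.inl (Or.inr ⟨⟨hod, hout a hab (Or.inl rfl)⟩,
          hout c (Ne.symm hbc) (Or.inr (Or.inr rfl))⟩)
      · exact Or.inr ⟨⟨hod, hout a hac (Or.inl rfl)⟩, hout b hbc (Or.inr (Or.inl rfl))⟩
    have hbc' := hpair b (by simp) c (by simp) hbc
    have hac' := hpair a (by simp) c (by simp) hac
    calc μ.real _ ≤ μ.real ((openConn o a ∩ (openConn o b)ᶜ ∩ (openConn o c)ᶜ) ∪
            (openConn o b ∩ (openConn o a)ᶜ ∩ (openConn o c)ᶜ) ∪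
            (openConn o c ∩ (openConn o a)ᶜ ∩ (openConn o b)ᶜ)) := measureReal_mono hsub
      _ ≤ μ.real (openConn o a ∩ (openConn o b)ᶜ ∩ (openConn o c)ᶜ) +
            μ.real (openConn o b ∩ (openConn o a)ᶜ ∩ (openConn o c)ᶜ) +
            μ.real (openConn o c ∩ (openConn o a)ᶜ ∩ (openConn o b)ᶜ) :=
          (measureReal_union_le _ _).trans (by gcongr; exact measureReal_union_le _ _)
      _ ≤ max (μ.real (openConn b c)ᶜ) (μ.real (openConn a c)ᶜ) := lonelyRelay_three w o a b c
      _ ≤ t := max_le hbc' hac'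
  · -- `|A| ≤ 2`: the event is empty (`1 ≤ N < E N / 2 ≤ 1` is impossible)
    have hA2 : (A.card : ℝ) ≤ 2 := by
      have : A.card ≤ 2 := by omega
      exact_mod_cast this
    have hempty : {ω : BondConfig (Fin n) |
          1 ≤ (A.filter fun a => ω ∈ openConn o a).card ∧
          ((A.filter fun a => ω ∈ openConn o a).card : ℝ) <
            (∑ a ∈ A, μ.real (openConn o a)) / 2} = ∅ := by
      ext ω
      simp only [mem_setOf_eq, mem_empty_iff_false, iff_false, not_and, not_lt]
      intro h1
      have : (1 : ℝ) ≤ (A.filter fun a => ω ∈ openConn o a).card := by exact_mod_cast h1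
      linarith
    rw [hempty, measureReal_empty]
    exact ht

end Summit.CriticalPhenomena.PercolationContinuityZ3.Theorems
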